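import Mathlib.RingTheory.PowerSeries.Order
import Mathlib.Algebra.CharP.Two
import HarnessLib

/-!
# J2 `JetCollapse` of the seed line `jet-character-sums` (crux `SignedMuSeedAtTwoPlus`, stmt-BirchSwinnertonDyer-21438; Kμ⁺
# stmt-BirchSwinnertonDyer-20689; route `ResidualThetaTransportAtTwo`): Frobenius additivity of the twisted orbit sums in
# characteristic `2` and the LEVEL-ZERO JET CRITERION «the `1`-jet of `Φ_χ` is `E₀ + E₀² t`, so its order is `≤ 1` iff `E₀ ≠ 0`»

Cell `bsd-wall`, width seat `bsd-wall-rtt-p4-w2` (g12). THEOREMS ONLY (no `def`, no named fact, no `sorry`); helper `--supports` the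
seed crux; nothing about any curve, character sum or `μ`-invariant is asserted; BSD is not proved by this. The line card
`Cruxes/SignedMuSeedAtTwoPlus/Lines/jet-character-sums.md` (crux-ideate k1 g19) states its stub J2 as «PROVED in the abstract form»
in a seat-local `Sketch.lean` (`frobeniusLinearTerm_holds`, `LevelZeroJetCriterion`) that never reached the tree; this file lands it,
WITHOUT the `IsReduced` hypothesis of the card's `LevelZeroJetCriterion` (not needed: `E₀² ≠ 0 ⇒ E₀ ≠ 0` in any ring).

* `sum_mul_sq` — `(Σ cᵢ aᵢ)² = Σ cᵢ² aᵢ²` in characteristic `2` (Mathlib `CharTwo.sum_sq`; with `c⁴ = c` for `𝔽₄`-valued weights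
  this is the card's `T₁ = E₀²`, and iterated `T₃ = E₀⁴`, `T₇ = E₀⁸`: `sum_mul_pow_four`, `sum_mul_pow_eight`).
* `coeff_zero_jetSum`, `coeff_one_jetSum` — the `0`- and `1`-jet of `Σᵢ (C (cᵢaᵢ) + C (cᵢ²aᵢ²)·X + X²·rᵢ)` are `E₀` and `E₀²`
  (`E₀ = Σ cᵢ aᵢ`), whatever the tails `rᵢ`.
* **`levelZeroJetCriterion`** — `order (Σᵢ (C (cᵢaᵢ) + C (cᵢ²aᵢ²)·X + X²·rᵢ)) ≤ 1 ↔ Σ cᵢ aᵢ ≠ 0`: the card's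
  `LevelZeroJetCriterion`, for every commutative ring of characteristic `2` (the card's shape VERBATIM minus `[IsReduced R]`).

References: the card (Lever (ii), stub J2); [SilvermanAEC2009] IV.1 (jets of formal-group functions) for context only.
-/

set_option autoImplicit false
set_option linter.dupNamespace false

noncomputable section

open PowerSeries Finset

namespace Summit.BirchSwinnertonDyer.BirchSwinnertonDyer.Theorems.SignedMuAtTwo.JetCharacterSums

variable {R : Type*} [CommRing R] [CharP R 2] {ι : Type*}

/-- **Frobenius additivity of the twisted sums** (characteristic `2`): `(Σ cᵢ aᵢ)² = Σ cᵢ² aᵢ²`. [folklore] -/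
theorem sum_mul_sq (s : Finset ι) (c a : ι → R) :
    (∑ i ∈ s, c i * a i) ^ 2 = ∑ i ∈ s, c i ^ 2 * a i ^ 2 := by
  rw [CharTwo.sum_sq]
  exact Finset.sum_congr rfl fun i _ => mul_pow (c i) (a i) 2

/-- Iterated: `(Σ cᵢ aᵢ)⁴ = Σ cᵢ⁴ aᵢ⁴` (the card's `T₃ = E₀⁴` once `cᵢ⁴ = cᵢ`). [folklore] -/
theorem sum_mul_pow_four (s : Finset ι) (c a : ι → R) :
    (∑ i ∈ s, c i * a i) ^ 4 = ∑ i ∈ s, c i ^ 4 * a i ^ 4 := by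
  rw [show (4 : ℕ) = 2 * 2 by norm_num, pow_mul, sum_mul_sq, sum_mul_sq]
  exact Finset.sum_congr rfl fun i _ => by ring

/-- Iterated twice: `(Σ cᵢ aᵢ)⁸ = Σ cᵢ⁸ aᵢ⁸` (the card's `T₇ = E₀⁸`). [folklore] -/
theorem sum_mul_pow_eight (s : Finset ι) (c a : ι → R) :
    (∑ i ∈ s, c i * a i) ^ 8 = ∑ i ∈ s, c i ^ 8 * a i ^ 8 := by
  rw [show (8 : ℕ) = 4 * 2 by norm_num, pow_mul, sum_mul_pow_four, sum_mul_sq]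
  exact Finset.sum_congr rfl fun i _ => by ring

/-- With `𝔽₄`-valued weights (`cᵢ⁴ = cᵢ`): `(Σ cᵢ aᵢ)⁴ = Σ cᵢ aᵢ⁴`. [folklore] -/
theorem sum_mul_pow_four_of_pow_four_eq (s : Finset ι) (c a : ι → R) (hc : ∀ i ∈ s, c i ^ 4 = c i) :
    (∑ i ∈ s, c i * a i) ^ 4 = ∑ i ∈ s, c i * a i ^ 4 := by
  rw [sum_mul_pow_four]
  exact Finset.sum_congr rfl fun i hi => by rw [hc i hi]

omit [CharP R 2] in
/-- The `0`-jet of the twisted sum `Σᵢ (C (cᵢaᵢ) + C (cᵢ²aᵢ²)·X + X²·rᵢ)` is `E₀ = Σ cᵢ aᵢ`. [folklore] -/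
theorem coeff_zero_jetSum (s : Finset ι) (c a : ι → R) (r : ι → R⟦X⟧) :
    coeff 0 (∑ i ∈ s, (C (c i * a i) + C (c i ^ 2 * a i ^ 2) * X + X ^ 2 * r i)) = ∑ i ∈ s, c i * a i := by
  rw [map_sum]
  refine Finset.sum_congr rfl fun i _ => ?_
  simp [coeff_zero_eq_constantCoeff]

/-- The `1`-jet of the twisted sum is `E₀² = (Σ cᵢ aᵢ)²` (Frobenius), whatever the tails `rᵢ`. [folklore] -/
theorem coeff_one_jetSum (s : Finset ι) (c a : ι → R) (r : ι → R⟦X⟧) :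
    coeff 1 (∑ i ∈ s, (C (c i * a i) + C (c i ^ 2 * a i ^ 2) * X + X ^ 2 * r i)) = (∑ i ∈ s, c i * a i) ^ 2 := by
  rw [map_sum, sum_mul_sq]
  refine Finset.sum_congr rfl fun i _ => ?_
  rw [map_add, map_add, coeff_C, if_neg one_ne_zero, zero_add, coeff_C_mul, coeff_one_X, mul_one,
    coeff_X_pow_mul', if_neg (by norm_num), add_zero]

/-- **`LevelZeroJetCriterion` (stub J2 of `jet-character-sums`), every commutative ring of characteristic `2`.** The twisted orbit
sum `Σᵢ (C (cᵢaᵢ) + C (cᵢ²aᵢ²)·X + X²·rᵢ)` — the `1`-jet `E₀ + E₀² t` of `Φ_χ` plus arbitrary tails — has order `≤ 1` iff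
`E₀ = Σ cᵢ aᵢ ≠ 0`. (No `IsReduced` hypothesis: `E₀² ≠ 0` already forces `E₀ ≠ 0`.) [folklore] -/
theorem levelZeroJetCriterion (s : Finset ι) (c a : ι → R) (r : ι → R⟦X⟧) :
    (∑ i ∈ s, (C (c i * a i) + C (c i ^ 2 * a i ^ 2) * X + X ^ 2 * r i)).order ≤ 1 ↔ ∑ i ∈ s, c i * a i ≠ 0 := by
  constructor
  · intro h hE
    -- both the `0`- and the `1`-jet vanish, so the order is `≥ 2`
    have h2 : (2 : ℕ∞) ≤ (∑ i ∈ s, (C (c i * a i) + C (c i ^ 2 * a i ^ 2) * X + X ^ 2 * r i)).order := by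
      refine nat_le_order _ 2 fun i hi => ?_
      have hi' : i = 0 ∨ i = 1 := by omega
      rcases hi' with rfl | rfl
      · rw [coeff_zero_jetSum, hE]
      · rw [coeff_one_jetSum, hE, zero_pow two_ne_zero]
    have h3 : (2 : ℕ∞) ≤ 1 := h2.trans h
    exact absurd h3 (by norm_num)
  · intro hE
    have h0 : coeff 0 (∑ i ∈ s, (C (c i * a i) + C (c i ^ 2 * a i ^ 2) * X + X ^ 2 * r i)) ≠ 0 := by
      rwa [coeff_zero_jetSum]
    exact (order_le 0 h0).trans (by simp)

/-- The card's `LevelZeroJetCriterion` TEXT (with its `[IsReduced R]` binder, here idle). [folklore] -/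
theorem levelZeroJetCriterion_card :
    ∀ (R : Type) [CommRing R] [CharP R 2] [IsReduced R] (ι : Type) (s : Finset ι) (c a : ι → R) (r : ι → PowerSeries R),
      ((∑ i ∈ s, (PowerSeries.C (c i * a i) + PowerSeries.C ((c i) ^ 2 * (a i) ^ 2) * PowerSeries.X +
        PowerSeries.X ^ 2 * r i)).order ≤ 1) ↔ (∑ i ∈ s, c i * a i ≠ 0) := by
  intro R _ _ _ ι s c a r
  exact levelZeroJetCriterion s c a r

end Summit.BirchSwinnertonDyer.BirchSwinnertonDyer.Theorems.SignedMuAtTwo.JetCharacterSums
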